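import Literature.Geometry.Riemannian.KernelNashEntropyPole
import Literature.Geometry.Riemannian.RicciFlowHeatKernelFn
import Mathlib.Analysis.Convex.Integral
import Mathlib.Analysis.SpecialFunctions.Log.NegMulLog
import Mathlib.MeasureTheory.Integral.Prod
import HarnessLib

/-!
# Averaging the pointed Nash entropy of the conjugate heat kernel against a heat kernel measure:
# the Jensen half of Bamler 2020a, (5.15)

R. Bamler, *Entropy and heat kernel bounds on a Ricci flow background*, arXiv:2008.07093 (2020a),
§5.4, second inequality of (5.15): for the conjugate heat kernels `K` of a Ricci flow and
`s < σ < t`, the pointed Nash entropy `𝒩*_s(z, σ) = 𝒩_{z,σ}(σ − s)` averaged against the heat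
kernel measure `ν_{x,t;σ}` is bounded by the pointed Nash entropy at the later base point,

  `∫ 𝒩*_s(z, σ) dν_{x,t;σ}(z) ≤ 𝒩*_s(x, t) + (m/2) log((t − s)/(σ − s))`.

Bamler derives this from `□𝒩* ≥ −m/(2τ)`; here it is proved DIRECTLY by Jensen's inequality: with
`Λ(u) = −u log u` (concave on `[0, ∞)`), `𝒩*_s(z, σ) = ∫ Λ(K(z,σ;y,s)) dg_s(y) − (m/2)log(4π(σ−s))
− m/2` (`IsRicciFlow.kernelNashEntropy_eq`), the reproduction formula
`K(x,t;y,s) = ∫ K(z,σ;y,s) dν_{x,t;σ}(z)` (`IsRicciFlow.heatKernelFn_reproduction`) and Jensen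
(`ConcaveOn.le_map_integral`) give `∫ Λ(K(z,σ;y,s)) dν_{x,t;σ}(z) ≤ Λ(K(x,t;y,s))` pointwise in
`y`; integrating in `y` and swapping the order of integration (Fubini, the integrand is jointly
continuous on the compact `M × M`) gives the entropy part, and
`−(m/2)log(4π(σ−s)) = −(m/2)log(4π(t−s)) + (m/2)log((t−s)/(σ−s))` the rest.

* `IsRicciFlow.continuous_heatKernelFn_basePoint_target` — `(z, y) ↦ K(z,σ;y,s)` is continuous
  on `M × M` for `a < s < σ ≤ T`;
* `IsRicciFlow.integral_negMulLog_heatKernelFn_heatKernelMeasure_le` — the pointwise Jensen step;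
* `integral_kernelNashEntropy_heatKernelMeasure_le` — **the averaged entropy bound** above, for a
  Ricci flow `hflow = (h, cov)` on `[a, T]` of a `C^∞` family of Riemannian metrics on a closed
  connected manifold `M` (modelled on `ℝᵐ`), `a < s < σ < t ≤ T`.

Everything is proved; no definitions, no named facts. What is NOT here: the first inequality of
(5.15), `𝒩*_s(x, t) ≤ ∫ 𝒩*_s(z, σ) dν_{x,t;σ}(z)` (which rests on the upper bound `□𝒩*_s ≤ 0`
of §5), the evolution bounds `−m/(2(t−s)) ≤ □𝒩*_s ≤ 0` and the gradient bound for `𝒩*_s`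
themselves, and the oscillation corollaries of §5.4 that combine (5.15) with the
`W₁`-Lipschitz bound.

## References

* R. H. Bamler, *Entropy and heat kernel bounds on a Ricci flow background*, arXiv:2008.07093
  (2020), §5.1 Def. 5.1, §5.4 (5.15). [Bamler2020Entropy]
-/

noncomputable section

open Bundle Set Function Filter Manifold MeasureTheory Measure TopologicalSpace
open scoped Manifold ContDiff Topology ENNReal NNReal

namespace Literature.Geometry.Riemannian

open Lorentzian Lorentzian.PseudoRiemannianMetric

section Jensen

variable {m : ℕ} {H : Type*} [TopologicalSpace H]
  {I : ModelWithCorners ℝ (EuclideanSpace ℝ (Fin m)) H} [I.Boundaryless]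
  {M : Type*} [TopologicalSpace M] [ChartedSpace H M] [IsManifold I ∞ M]
  [T2Space M] [CompactSpace M] [SecondCountableTopology M] [MeasurableSpace M] [BorelSpace M]
  [PreconnectedSpace M]
  {h : ℝ → PseudoRiemannianMetric I ∞ (EuclideanSpace ℝ (Fin m)) (TangentSpace I : M → Type _)}
  {cov : ℝ → CovariantDerivative I (EuclideanSpace ℝ (Fin m)) (TangentSpace I : M → Type _)}
  {a T : ℝ} (hflow : IsRicciFlow h cov (Icc a T)) (hh : IsContMDiffFamilyOn ∞ h univ)
  (hR : ∀ r, (h r).IsRiemannian)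

/-- `(z, y) ↦ K(z,σ;y,s)` is jointly continuous on `M × M` for `a < s < σ ≤ T` (a slice of the
continuity of `(z, (y, s)) ↦ K(z,σ;y,s)` on `M × (M × (a, σ))`). [cite: Bamler2020Entropy, §2.3] -/
theorem IsRicciFlow.continuous_heatKernelFn_basePoint_target {s σ : ℝ} (hσ : σ ∈ Ioc a T)
    (hs : s ∈ Ioo a σ) :
    Continuous fun p : M × M ↦ hflow.heatKernelFn hh hR σ p.1 (p.2, s) :=
  (hflow.continuousOn_heatKernelFn hh hR hσ).comp_continuous
    (continuous_fst.prodMk (continuous_snd.prodMk continuous_const))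
    fun _ ↦ ⟨mem_univ _, mem_univ _, hs⟩

/-- **Jensen for the kernel entropy integrand**: for `a < s < σ < t ≤ T` and every `y`,
`∫ Λ(K(z,σ;y,s)) dν_{x,t;σ}(z) ≤ Λ(K(x,t;y,s))`, where `Λ(u) = −u log u` is concave on `[0, ∞)`
and `K(x,t;y,s) = ∫ K(z,σ;y,s) dν_{x,t;σ}(z)` (reproduction formula).
[cite: Bamler2020Entropy, §5.4, (5.15)] -/
theorem IsRicciFlow.integral_negMulLog_heatKernelFn_heatKernelMeasure_le {s σ t : ℝ} (has : a < s)
    (hsσ : s < σ) (hσt : σ < t) (htT : t ≤ T) (x y : M) :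
    ∫ z, Real.negMulLog (hflow.heatKernelFn hh hR σ z (y, s)) ∂(heatKernelMeasure hh hR t x σ) ≤
      Real.negMulLog (hflow.heatKernelFn hh hR t x (y, s)) := by
  have hσ : σ ∈ Ioc a T := ⟨has.trans hsσ, hσt.le.trans htT⟩
  have hs : s ∈ Ioo a σ := ⟨has, hsσ⟩
  have hKc : Continuous fun z ↦ hflow.heatKernelFn hh hR σ z (y, s) :=
    (hflow.continuous_heatKernelFn_basePoint_target hh hR hσ hs).comp
      (continuous_id.prodMk continuous_const)
  have hKi : Integrable (fun z ↦ hflow.heatKernelFn hh hR σ z (y, s))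
      (heatKernelMeasure hh hR t x σ) :=
    hKc.integrable_of_hasCompactSupport (HasCompactSupport.of_compactSpace _)
  have hΛi : Integrable (Real.negMulLog ∘ fun z ↦ hflow.heatKernelFn hh hR σ z (y, s))
      (heatKernelMeasure hh hR t x σ) :=
    (Real.continuous_negMulLog.comp hKc).integrable_of_hasCompactSupport
      (HasCompactSupport.of_compactSpace _)
  rw [hflow.heatKernelFn_reproduction hh hR (has.trans hsσ) hσt htT x hs y]
  exact Real.concaveOn_negMulLog.le_map_integral Real.continuous_negMulLog.continuousOn
    isClosed_Ici (Eventually.of_forall fun z ↦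
      (hflow.heatKernelFn_pos hh hR hσ z ⟨mem_univ _, hs⟩).le) hKi hΛi

omit [PreconnectedSpace M] in
/-- `log(4π(t − s)) − log(4π(σ − s)) = log((t − s)/(σ − s))` for `s < σ < t`. [folklore] -/
private theorem log_four_pi_mul_sub_sub_log {s σ t : ℝ} (hsσ : s < σ) (hσt : σ < t) :
    Real.log (4 * Real.pi * (t - s)) - Real.log (4 * Real.pi * (σ - s)) =
      Real.log ((t - s) / (σ - s)) := by
  have h1 : 0 < σ - s := sub_pos.2 hsσ
  have h2 : 0 < t - s := sub_pos.2 (hsσ.trans hσt)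
  rw [Real.log_mul (by positivity) h2.ne', Real.log_mul (by positivity) h1.ne',
    Real.log_div h2.ne' h1.ne']
  ring

/-- **Bamler 2020a, (5.15), second inequality (Jensen half)**: for a Ricci flow on a closed
manifold, `a < s < σ < t ≤ T` and every `x`,
`∫ 𝒩*_s(z, σ) dν_{x,t;σ}(z) ≤ 𝒩*_s(x, t) + (m/2) log((t − s)/(σ − s))`, where
`𝒩*_s(z, σ) = pointedNashEntropy h (K(z,σ;·,·)) m σ s` is the pointed Nash entropy of the conjugate
heat kernel based at `(z, σ)`, evaluated at time `s`. Proof: `kernelNashEntropy_eq`, the pointwise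
Jensen inequality `integral_negMulLog_heatKernelFn_heatKernelMeasure_le`, Fubini on `M × M`, and
`−(m/2)log(4π(σ−s)) = −(m/2)log(4π(t−s)) + (m/2)log((t−s)/(σ−s))`.
[cite: Bamler2020Entropy, §5.4, (5.15)] -/
theorem integral_kernelNashEntropy_heatKernelMeasure_le {s σ t : ℝ} (has : a < s) (hsσ : s < σ)
    (hσt : σ < t) (htT : t ≤ T) (x : M) :
    ∫ z, pointedNashEntropy h (fun r y ↦ hflow.heatKernelFn hh hR σ z (y, r)) m σ s
        ∂(heatKernelMeasure hh hR t x σ) ≤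
      pointedNashEntropy h (fun r y ↦ hflow.heatKernelFn hh hR t x (y, r)) m t s +
        (m : ℝ) / 2 * Real.log ((t - s) / (σ - s)) := by
  have hσ : σ ∈ Ioc a T := ⟨has.trans hsσ, hσt.le.trans htT⟩
  have ht : t ∈ Ioc a T := ⟨(has.trans hsσ).trans hσt, htT⟩
  have hs : s ∈ Ioo a σ := ⟨has, hsσ⟩
  have hst : s ∈ Ioo a t := ⟨has, hsσ.trans hσt⟩
  haveI : IsFiniteMeasure (h s).riemVolume := ⟨(h s).riemVolume_univ_lt_top⟩
  -- notation
  set ν : Measure M := heatKernelMeasure hh hR t x σ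
  set μ : Measure M := (h s).riemVolume with hμ
  set K : M → M → ℝ := fun z y ↦ hflow.heatKernelFn hh hR σ z (y, s) with hK
  set Kt : M → ℝ := fun y ↦ hflow.heatKernelFn hh hR t x (y, s) with hKt
  set c : ℝ := (m : ℝ) / 2 * Real.log (4 * Real.pi * (σ - s)) + (m : ℝ) / 2 with hc
  -- the explicit form of the two Nash entropies
  have hL : ∀ z, pointedNashEntropy h (fun r y ↦ hflow.heatKernelFn hh hR σ z (y, r)) m σ s =
      ∫ y, Real.negMulLog (K z y) ∂μ - c := by
    intro z
    rw [hflow.kernelNashEntropy_eq hh hR hσ z hs, hc]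
    simp only [Real.negMulLog, neg_mul, hK, hμ]
    ring
  have hRt : pointedNashEntropy h (fun r y ↦ hflow.heatKernelFn hh hR t x (y, r)) m t s =
      ∫ y, Real.negMulLog (Kt y) ∂μ - (m : ℝ) / 2 * Real.log (4 * Real.pi * (t - s)) -
        (m : ℝ) / 2 := by
    rw [hflow.kernelNashEntropy_eq hh hR ht x hst]
    simp only [Real.negMulLog, neg_mul, hKt, hμ]
  -- joint continuity and integrability on `M × M`
  have hKc : Continuous (uncurry K) := hflow.continuous_heatKernelFn_basePoint_target hh hR hσ hs
  have hΛc : Continuous (uncurry fun z y ↦ Real.negMulLog (K z y)) :=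
    Real.continuous_negMulLog.comp hKc
  have hΛi : Integrable (uncurry fun z y ↦ Real.negMulLog (K z y)) (ν.prod μ) :=
    hΛc.integrable_of_hasCompactSupport (HasCompactSupport.of_compactSpace _)
  have hSi : Integrable (fun z ↦ ∫ y, Real.negMulLog (K z y) ∂μ) ν := hΛi.integral_prod_left
  have hTi : Integrable (fun y ↦ ∫ z, Real.negMulLog (K z y) ∂ν) μ := hΛi.integral_prod_right
  have hKtc : Continuous Kt := hflow.continuous_heatKernelFn_slice hh hR ht x hst
  have hKti : Integrable (fun y ↦ Real.negMulLog (Kt y)) μ :=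
    (Real.continuous_negMulLog.comp hKtc).integrable_of_hasCompactSupport
      (HasCompactSupport.of_compactSpace _)
  -- the entropy part: Fubini + Jensen
  have hmain : ∫ z, (∫ y, Real.negMulLog (K z y) ∂μ) ∂ν ≤ ∫ y, Real.negMulLog (Kt y) ∂μ := by
    rw [integral_integral_swap hΛi]
    exact integral_mono hTi hKti fun y ↦
      hflow.integral_negMulLog_heatKernelFn_heatKernelMeasure_le hh hR has hsσ hσt htT x y
  -- bookkeeping
  have hLint : ∫ z, pointedNashEntropy h (fun r y ↦ hflow.heatKernelFn hh hR σ z (y, r)) m σ s ∂ν =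
      ∫ z, (∫ y, Real.negMulLog (K z y) ∂μ) ∂ν - c := by
    simp_rw [hL]
    rw [integral_sub hSi (integrable_const c), integral_const, smul_eq_mul, probReal_univ, one_mul]
  rw [hLint, hRt, hc, ← log_four_pi_mul_sub_sub_log hsσ hσt]
  linarith [hmain]

end Jensen

end Literature.Geometry.Riemannian

end
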